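import Literature.NumberTheory.LFunctions.ZetaTruncationUniform
import HarnessLib

/-!
# Titchmarsh's Theorem 4.11, eq. (4.11.1), up to the stationary range: `|t| ≤ 2πM(1 − δ)`

Topic `Literature/NumberTheory/LFunctions`; everything PROVED. The tree's
`Literature.NumberTheory.LFunctions.norm_zeta_sub_sum_add_le_uniform` proves (4.11.1),
`ζ(s) = ∑_{n≤M} n^{−s} − M^{1−s}/(1−s) + O(M^{−σ})`, for `|t| ≤ 4M` (the book: `|t| < 2πx/C`,
any `C > 1`, constants depending on `C`). For the second moments of `ζ`-partial sums at the zeros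
(route `EtaLeadingQuarter`) the whole pre-stationary range `t ≤ 2πM(1 − δ)` is needed, with the
`1/δ` dependence explicit: here `‖ζ(s) − ∑_{n≤M} n^{−s} + M^{1−s}/(1−s)‖ ≤ (3 + 2/δ) M^{−σ}` for
`0 < σ ≤ 2`, `0 < t ≤ 2πM(1−δ)`, `0 < δ ≤ 1`. Only the positive-frequency oscillatory sum
changes (`2πνM − t ≥ 2πMνδ`); everything else is the tree's proof verbatim.

## References

* E. C. Titchmarsh, *The Theory of the Riemann Zeta-Function*, 2nd ed. (rev. D. R. Heath-Brown),
  Oxford 1986, §4.11, Theorem 4.11, eq. (4.11.1). [cite: Titchmarsh1986, Theorem 4.11]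
-/

noncomputable section

open Complex MeasureTheory Set Filter Finset
open scoped Real Topology ComplexConjugate

namespace Literature.NumberTheory.LFunctions

/-- The positive-frequency oscillatory terms of Lemma 4.10 for `∑_{M<n≤N} n^{-s}` below the
stationary range with a variable gap (`t ≤ 2πM(1 − δ)`, `0 < δ ≤ 1`): the `ν`-th integral is
`≤ 4M^{-σ}/(2πνM − t) ≤ 4M^{-σ}/(2πMνδ)`, so `∑_{ν ≤ V} ‖s (1/(2πiν)) ∫ …‖ ≤ (2/(π²δ)) |s| M^{-σ-1}`.
[cite: Titchmarsh1986, §4.11 proof of Theorem 4.11] -/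
theorem sum_norm_oscPos_le_of_gap {s : ℂ} (hσ : 0 < s.re) {M : ℕ} (hM : 1 ≤ M) {δ : ℝ}
    (hδ : 0 < δ) (hδ1 : δ ≤ 1) (htM : s.im ≤ 2 * π * M * (1 - δ)) {N : ℕ} (hMN : M ≤ N) (V : ℕ) :
    ∑ ν ∈ Finset.Icc 1 V,
        ‖s * ((1 / (2 * π * I * ν))
          * ∫ u in (M : ℝ)..N, (u : ℂ) ^ (-s - 1) * Complex.exp (((2 * π * ν * u : ℝ) : ℂ) * I))‖
      ≤ ‖s‖ * (M : ℝ) ^ (-s.re - 1) * (2 / (π ^ 2 * δ)) := by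
  have hπ := Real.pi_gt_three
  have hMpos : (0 : ℝ) < M := by exact_mod_cast hM
  have hMN' : (M : ℝ) ≤ N := by exact_mod_cast hMN
  have hterm : ∀ ν ∈ Finset.Icc 1 V,
      ‖s * ((1 / (2 * π * I * ν))
          * ∫ u in (M : ℝ)..N, (u : ℂ) ^ (-s - 1) * Complex.exp (((2 * π * ν * u : ℝ) : ℂ) * I))‖
        ≤ ‖s‖ * (M : ℝ) ^ (-s.re - 1) * (1 / (π ^ 2 * δ)) * (1 / (ν : ℝ) ^ 2) := by
    intro ν hν
    have hν1 : (1 : ℝ) ≤ ν := by exact_mod_cast (Finset.mem_Icc.1 hν).1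
    have hνpos : (0 : ℝ) < ν := by linarith
    -- `2πνM − t ≥ 2πMνδ`
    have hgap : 2 * π * M * ν * δ ≤ 2 * π * ν * M - s.im := by
      have h1 : 0 ≤ 2 * π * (M : ℝ) * ((ν - 1) * (1 - δ)) := by
        have : 0 ≤ ((ν : ℝ) - 1) * (1 - δ) := mul_nonneg (by linarith) (by linarith)
        positivity
      nlinarith
    have hden0 : 0 < 2 * π * (M : ℝ) * ν * δ := by positivity
    have hνa : s.im < 2 * π * ν * M := by linarith
    have hI := AFE.norm_integral_far_pos_le hσ hMpos hMN' hνpos hνa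
    rw [norm_mul, norm_mul, AFE.norm_one_div_two_pi_I_mul_nat hνpos]
    calc ‖s‖ * (1 / (2 * π * ν) * ‖∫ u in (M : ℝ)..N, (u : ℂ) ^ (-s - 1)
          * Complex.exp (((2 * π * ν * u : ℝ) : ℂ) * I)‖)
        ≤ ‖s‖ * (1 / (2 * π * ν) * (4 * ((M : ℝ) ^ (-s.re) / (2 * π * ν * M - s.im)))) := by
          gcongr
      _ ≤ ‖s‖ * (1 / (2 * π * ν) * (4 * ((M : ℝ) ^ (-s.re) / (2 * π * M * ν * δ)))) := by
          gcongr
      _ = ‖s‖ * (M : ℝ) ^ (-s.re - 1) * (1 / (π ^ 2 * δ)) * (1 / (ν : ℝ) ^ 2) := by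
          rw [Real.rpow_sub hMpos, Real.rpow_one]
          field_simp
          ring
  calc _ ≤ ∑ ν ∈ Finset.Icc 1 V, ‖s‖ * (M : ℝ) ^ (-s.re - 1) * (1 / (π ^ 2 * δ)) * (1 / (ν : ℝ) ^ 2) :=
        Finset.sum_le_sum hterm
    _ = ‖s‖ * (M : ℝ) ^ (-s.re - 1) * (1 / (π ^ 2 * δ)) * ∑ ν ∈ Finset.Icc 1 V, 1 / (ν : ℝ) ^ 2 := by
        rw [Finset.mul_sum]
    _ ≤ ‖s‖ * (M : ℝ) ^ (-s.re - 1) * (1 / (π ^ 2 * δ)) * 2 :=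
        mul_le_mul_of_nonneg_left (sum_Icc_one_div_sq_le_two V) (by positivity)
    _ = ‖s‖ * (M : ℝ) ^ (-s.re - 1) * (2 / (π ^ 2 * δ)) := by ring

/-- **(4.11.1) before the limits, variable gap**: for `0 < σ`, `0 < t ≤ 2πM(1−δ)`, `0 < δ ≤ 1`,
`1 ≤ M ≤ N`, `V ≥ 1`: `‖ζ(s) − ∑_{n≤M} n^{−s} + M^{1−s}/(1−s)‖ ≤ M^{−σ}/2 + |s| M^{−σ−1}(2/(π²δ) + 2/π²)`
`+ N^{−σ}(1 + |s|/(2σ)) + |s| M^{−σ−1}(N − M + 2) η_V`. [cite: Titchmarsh1986, §4.11 proof of Theorem 4.11] -/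
theorem norm_zeta_sub_sum_add_le_uniform_aux_of_gap {s : ℂ} (hσ : 0 < s.re) (ht : 0 < s.im)
    {M : ℕ} (hM : 1 ≤ M) {δ : ℝ} (hδ : 0 < δ) (hδ1 : δ ≤ 1) (htM : s.im ≤ 2 * π * M * (1 - δ))
    {N : ℕ} (hMN : M ≤ N) {V : ℕ} (hV : 1 ≤ V) :
    ‖riemannZeta s - ∑ n ∈ Finset.Icc 1 M, (n : ℂ) ^ (-s) + (M : ℂ) ^ (1 - s) / (1 - s)‖
      ≤ (M : ℝ) ^ (-s.re) / 2 + ‖s‖ * (M : ℝ) ^ (-s.re - 1) * (2 / (π ^ 2 * δ) + 2 / π ^ 2)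
        + (N : ℝ) ^ (-s.re) * (1 + ‖s‖ / (2 * s.re))
        + ‖s‖ * (M : ℝ) ^ (-s.re - 1) * ((N : ℝ) - M + 2) * AFE.sawEta V := by
  have hs1 : s ≠ 1 := by
    intro h; rw [h] at ht; simp at ht
  have hMpos : (0 : ℝ) < M := by exact_mod_cast hM
  have hNpos : (0 : ℝ) < N := by exact_mod_cast (hM.trans hMN)
  have hMN' : (M : ℝ) ≤ N := by exact_mod_cast hMN
  -- (4.11.2) at level `N`
  have hEM := AFE.norm_zeta_sub_sum_add_le hσ hs1 (hM.trans hMN)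
  -- Lemma 4.10 on `(M, N]`
  have hexp := AFE.norm_sum_Ioc_cpow_sub_expansion_le hσ hs1 (a := (M : ℝ)) (N := N) (V := V)
    hMpos hMN' hV
  rw [Nat.floor_natCast] at hexp
  -- the oscillatory terms
  have hP := sum_norm_oscPos_le_of_gap hσ hM hδ hδ1 htM hMN V
  have hQ := sum_norm_oscNeg_le hσ ht.le hM hMN V
  -- the boundary terms
  have hnormM : ‖(M : ℂ) ^ (-s)‖ = (M : ℝ) ^ (-s.re) := by
    rw [show (M : ℂ) = ((M : ℝ) : ℂ) by simp, Complex.norm_cpow_eq_rpow_re_of_pos hMpos]; simp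
  have hnormN : ‖(N : ℂ) ^ (-s)‖ = (N : ℝ) ^ (-s.re) := by
    rw [show (N : ℂ) = ((N : ℝ) : ℂ) by simp, Complex.norm_cpow_eq_rpow_re_of_pos hNpos]; simp
  have hsawM : ‖(AFE.saw (M : ℝ) : ℂ) * (M : ℂ) ^ (-s)‖ ≤ (M : ℝ) ^ (-s.re) / 2 := by
    rw [norm_mul, hnormM, Complex.norm_real, Real.norm_eq_abs]
    have := AFE.abs_saw_le (M : ℝ)
    have h0 : (0 : ℝ) ≤ (M : ℝ) ^ (-s.re) := by positivity
    nlinarith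
  have hsawN : ‖(AFE.saw (N : ℝ) : ℂ) * (N : ℂ) ^ (-s)‖ ≤ (N : ℝ) ^ (-s.re) / 2 := by
    rw [norm_mul, hnormN, Complex.norm_real, Real.norm_eq_abs]
    have := AFE.abs_saw_le (N : ℝ)
    have h0 : (0 : ℝ) ≤ (N : ℝ) ^ (-s.re) := by positivity
    nlinarith
  -- splitting `∑_{n ≤ N} = ∑_{n ≤ M} + ∑_{M < n ≤ N}`
  have hsplit : ∑ n ∈ Finset.Icc 1 N, (n : ℂ) ^ (-s)
      = ∑ n ∈ Finset.Icc 1 M, (n : ℂ) ^ (-s) + ∑ n ∈ Finset.Ioc M N, (n : ℂ) ^ (-s) := by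
    have e1 : Finset.Icc 1 N = Finset.Ioc 0 N := by
      ext n; simp only [Finset.mem_Icc, Finset.mem_Ioc]; omega
    have e2 : Finset.Icc 1 M = Finset.Ioc 0 M := by
      ext n; simp only [Finset.mem_Icc, Finset.mem_Ioc]; omega
    rw [e1, e2, Finset.sum_Ioc_consecutive _ (Nat.zero_le M) hMN]
  -- names
  set Z : ℂ := riemannZeta s - ∑ n ∈ Finset.Icc 1 N, (n : ℂ) ^ (-s) + (N : ℂ) ^ (1 - s) / (1 - s)
    with hZ
  set OP : ℕ → ℂ := fun ν => s * ((1 / (2 * π * I * ν))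
      * ∫ u in (M : ℝ)..N, (u : ℂ) ^ (-s - 1) * Complex.exp (((2 * π * ν * u : ℝ) : ℂ) * I))
    with hOP
  set ON : ℕ → ℂ := fun ν => s * ((1 / (2 * π * I * ν))
      * ∫ u in (M : ℝ)..N, (u : ℂ) ^ (-s - 1) * Complex.exp (((-(2 * π * ν) * u : ℝ) : ℂ) * I))
    with hON
  set R : ℂ := (∑ n ∈ Finset.Ioc M N, (n : ℂ) ^ (-s))
        - (((N : ℂ) ^ (1 - s) - ((M : ℝ) : ℂ) ^ (1 - s)) / (1 - s)
            + (AFE.saw (M : ℝ) : ℂ) * ((M : ℝ) : ℂ) ^ (-s) - (AFE.saw N : ℂ) * (N : ℂ) ^ (-s)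
            + s * ∑ ν ∈ Finset.Icc 1 V, (1 / (2 * π * I * ν)) *
                ((∫ u in (M : ℝ)..N, (u : ℂ) ^ (-s - 1) * Complex.exp (((2 * π * ν * u : ℝ) : ℂ) * I))
                  - ∫ u in (M : ℝ)..N, (u : ℂ) ^ (-s - 1)
                      * Complex.exp (((-(2 * π * ν) * u : ℝ) : ℂ) * I))) with hR
  have hRle : ‖R‖ ≤ ‖s‖ * (M : ℝ) ^ (-s.re - 1) * ((N : ℝ) - M + 2) * AFE.sawEta V := hexp
  -- the oscillatory sum as `∑ OP - ∑ ON`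
  have hosc : s * ∑ ν ∈ Finset.Icc 1 V, (1 / (2 * π * I * ν)) *
      ((∫ u in (M : ℝ)..N, (u : ℂ) ^ (-s - 1) * Complex.exp (((2 * π * ν * u : ℝ) : ℂ) * I))
        - ∫ u in (M : ℝ)..N, (u : ℂ) ^ (-s - 1) * Complex.exp (((-(2 * π * ν) * u : ℝ) : ℂ) * I))
      = ∑ ν ∈ Finset.Icc 1 V, OP ν - ∑ ν ∈ Finset.Icc 1 V, ON ν := by
    rw [← Finset.sum_sub_distrib, Finset.mul_sum]
    refine Finset.sum_congr rfl fun ν _ => ?_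
    simp only [hOP, hON]
    ring
  have hMcast : ((M : ℝ) : ℂ) = (M : ℂ) := by simp
  -- the decomposition of the quantity to be estimated
  have hdecomp : riemannZeta s - ∑ n ∈ Finset.Icc 1 M, (n : ℂ) ^ (-s) + (M : ℂ) ^ (1 - s) / (1 - s)
      = Z + R + (AFE.saw (M : ℝ) : ℂ) * (M : ℂ) ^ (-s) - (AFE.saw (N : ℝ) : ℂ) * (N : ℂ) ^ (-s)
        + (∑ ν ∈ Finset.Icc 1 V, OP ν - ∑ ν ∈ Finset.Icc 1 V, ON ν) := by
    rw [← hosc, hR, hZ, hsplit, hMcast]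
    have h1s : (1 : ℂ) - s ≠ 0 := sub_ne_zero.2 (Ne.symm hs1)
    field_simp
    ring
  rw [hdecomp]
  have hOPs : ‖∑ ν ∈ Finset.Icc 1 V, OP ν‖ ≤ ‖s‖ * (M : ℝ) ^ (-s.re - 1) * (2 / (π ^ 2 * δ)) :=
    (norm_sum_le _ _).trans hP
  have hONs : ‖∑ ν ∈ Finset.Icc 1 V, ON ν‖ ≤ ‖s‖ * (M : ℝ) ^ (-s.re - 1) * (2 / π ^ 2) :=
    (norm_sum_le _ _).trans hQ
  have hZle : ‖Z‖ ≤ (N : ℝ) ^ (-s.re) * (1 / 2 + ‖s‖ / (2 * s.re)) := hEM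
  calc ‖Z + R + (AFE.saw (M : ℝ) : ℂ) * (M : ℂ) ^ (-s) - (AFE.saw (N : ℝ) : ℂ) * (N : ℂ) ^ (-s)
        + (∑ ν ∈ Finset.Icc 1 V, OP ν - ∑ ν ∈ Finset.Icc 1 V, ON ν)‖
      ≤ ‖Z‖ + ‖R‖ + ‖(AFE.saw (M : ℝ) : ℂ) * (M : ℂ) ^ (-s)‖
          + ‖(AFE.saw (N : ℝ) : ℂ) * (N : ℂ) ^ (-s)‖
          + (‖∑ ν ∈ Finset.Icc 1 V, OP ν‖ + ‖∑ ν ∈ Finset.Icc 1 V, ON ν‖) := by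
        refine (norm_add_le _ _).trans (add_le_add ((norm_sub_le _ _).trans
          (add_le_add ((norm_add_le _ _).trans (add_le_add (norm_add_le _ _) le_rfl)) le_rfl))
          (norm_sub_le _ _))
    _ ≤ (N : ℝ) ^ (-s.re) * (1 / 2 + ‖s‖ / (2 * s.re))
          + ‖s‖ * (M : ℝ) ^ (-s.re - 1) * ((N : ℝ) - M + 2) * AFE.sawEta V
          + (M : ℝ) ^ (-s.re) / 2 + (N : ℝ) ^ (-s.re) / 2
          + (‖s‖ * (M : ℝ) ^ (-s.re - 1) * (2 / (π ^ 2 * δ)) + ‖s‖ * (M : ℝ) ^ (-s.re - 1) * (2 / π ^ 2)) := by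
        gcongr
    _ = _ := by ring

/-- **(4.11.1) up to the stationary range**: for `0 < σ ≤ 2`, `0 < t ≤ 2πM(1 − δ)`, `0 < δ ≤ 1`,
`M ≥ 1`: `‖ζ(s) − ∑_{n=1}^{M} n^{−s} + M^{1−s}/(1−s)‖ ≤ (3 + 2/δ) M^{−σ}`.
[cite: Titchmarsh1986, Theorem 4.11, eq. (4.11.1)] -/
theorem norm_zeta_sub_sum_add_le_uniform_of_gap {s : ℂ} (hσ : 0 < s.re) (hσ2 : s.re ≤ 2)
    (ht : 0 < s.im) {M : ℕ} (hM : 1 ≤ M) {δ : ℝ} (hδ : 0 < δ) (hδ1 : δ ≤ 1)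
    (htM : s.im ≤ 2 * π * M * (1 - δ)) :
    ‖riemannZeta s - ∑ n ∈ Finset.Icc 1 M, (n : ℂ) ^ (-s) + (M : ℂ) ^ (1 - s) / (1 - s)‖
      ≤ (3 + 2 / δ) * (M : ℝ) ^ (-s.re) := by
  have hπ := Real.pi_gt_three
  have hMpos : (0 : ℝ) < M := by exact_mod_cast hM
  have hM1 : (1 : ℝ) ≤ M := by exact_mod_cast hM
  set E : ℝ := ‖riemannZeta s - ∑ n ∈ Finset.Icc 1 M, (n : ℂ) ^ (-s)
    + (M : ℂ) ^ (1 - s) / (1 - s)‖ with hE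
  set B : ℝ := (M : ℝ) ^ (-s.re) / 2 + ‖s‖ * (M : ℝ) ^ (-s.re - 1) * (2 / (π ^ 2 * δ) + 2 / π ^ 2)
    with hB
  -- `|s| ≤ 9M`
  have hns : ‖s‖ ≤ 9 * M := by
    have h := Complex.norm_le_abs_re_add_abs_im s
    rw [abs_of_pos hσ, abs_of_pos ht] at h
    have hπ4 := Real.pi_lt_d2
    have : s.im ≤ 2 * π * M := by nlinarith
    nlinarith
  -- `B ≤ (3 + 2/δ) M^{-σ}`
  have hBle : B ≤ (3 + 2 / δ) * (M : ℝ) ^ (-s.re) := by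
    have hsplit : (M : ℝ) ^ (-s.re - 1) = (M : ℝ) ^ (-s.re) / M := by
      rw [Real.rpow_sub hMpos, Real.rpow_one]
    have h1 : ‖s‖ * (M : ℝ) ^ (-s.re - 1) ≤ 9 * (M : ℝ) ^ (-s.re) := by
      rw [hsplit, mul_div_assoc']
      rw [div_le_iff₀ hMpos]
      have h0 : (0 : ℝ) ≤ (M : ℝ) ^ (-s.re) := by positivity
      nlinarith
    have hπ2 : (9 : ℝ) ≤ π ^ 2 := by nlinarith
    have e1 : 2 / (π ^ 2 * δ) ≤ 2 / (9 * δ) :=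
      div_le_div_of_nonneg_left (by norm_num) (by positivity) (by nlinarith)
    have e2 : 2 / π ^ 2 ≤ 2 / 9 := div_le_div_of_nonneg_left (by norm_num) (by norm_num) hπ2
    have h4 : (0 : ℝ) ≤ (M : ℝ) ^ (-s.re) := by positivity
    have hδ9 : 0 < 2 / (9 * δ) := by positivity
    have key : ‖s‖ * (M : ℝ) ^ (-s.re - 1) * (2 / (π ^ 2 * δ) + 2 / π ^ 2) ≤
        9 * (M : ℝ) ^ (-s.re) * (2 / (9 * δ) + 2 / 9) :=
      mul_le_mul h1 (by linarith) (by positivity) (by positivity)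
    have e3 : 9 * (M : ℝ) ^ (-s.re) * (2 / (9 * δ) + 2 / 9) = (M : ℝ) ^ (-s.re) * (2 / δ + 2) := by
      field_simp
    rw [hB]
    nlinarith [key, e3, h4]
  -- `E ≤ B + ε` for every `ε > 0`
  have hEle : ∀ ε : ℝ, 0 < ε → E ≤ B + ε := by
    intro ε hε
    -- choose `N`
    have hlim : Tendsto (fun N : ℕ => (N : ℝ) ^ (-s.re) * (1 + ‖s‖ / (2 * s.re))) atTop
        (𝓝 (0 * (1 + ‖s‖ / (2 * s.re)))) :=
      ((tendsto_rpow_neg_atTop hσ).comp tendsto_natCast_atTop_atTop).mul_const _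
    rw [zero_mul] at hlim
    obtain ⟨N, hN⟩ := ((hlim.eventually (gt_mem_nhds (half_pos hε))).and
      (eventually_ge_atTop M)).exists
    obtain ⟨hN1, hMN⟩ := hN
    -- choose `V`
    have hcoef : 0 < ‖s‖ * (M : ℝ) ^ (-s.re - 1) * ((N : ℝ) - M + 2) + 1 := by
      have : (M : ℝ) ≤ N := by exact_mod_cast hMN
      have : 0 ≤ ‖s‖ * (M : ℝ) ^ (-s.re - 1) * ((N : ℝ) - M + 2) :=
        mul_nonneg (by positivity) (by linarith)
      linarith
    obtain ⟨V₀, hV₀, hV⟩ := AFE.exists_sawEta_le (δ := ε / 2 /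
      (‖s‖ * (M : ℝ) ^ (-s.re - 1) * ((N : ℝ) - M + 2) + 1)) (by positivity)
    have hmain := norm_zeta_sub_sum_add_le_uniform_aux_of_gap hσ ht hM hδ hδ1 htM hMN hV₀
    have hsaw := hV V₀ le_rfl
    have hMN' : (M : ℝ) ≤ N := by exact_mod_cast hMN
    have hc0 : 0 ≤ ‖s‖ * (M : ℝ) ^ (-s.re - 1) * ((N : ℝ) - M + 2) :=
      mul_nonneg (by positivity) (by linarith)
    have hlast : ‖s‖ * (M : ℝ) ^ (-s.re - 1) * ((N : ℝ) - M + 2) * AFE.sawEta V₀ ≤ ε / 2 := by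
      calc ‖s‖ * (M : ℝ) ^ (-s.re - 1) * ((N : ℝ) - M + 2) * AFE.sawEta V₀
          ≤ ‖s‖ * (M : ℝ) ^ (-s.re - 1) * ((N : ℝ) - M + 2) * (ε / 2 /
              (‖s‖ * (M : ℝ) ^ (-s.re - 1) * ((N : ℝ) - M + 2) + 1)) :=
            mul_le_mul_of_nonneg_left hsaw hc0
        _ ≤ ε / 2 := by
            rw [mul_div_assoc', div_le_iff₀ hcoef]
            nlinarith
    have : E ≤ B + (N : ℝ) ^ (-s.re) * (1 + ‖s‖ / (2 * s.re))
        + ‖s‖ * (M : ℝ) ^ (-s.re - 1) * ((N : ℝ) - M + 2) * AFE.sawEta V₀ := hmain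
    linarith
  have hEB : E ≤ B := le_of_forall_pos_lt_add fun ε hε => by
    have := hEle (ε / 2) (half_pos hε); linarith
  exact hEB.trans hBle


end Literature.NumberTheory.LFunctions

end
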